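import Summits.NavierStokesRegularity.TurbBounds.Certs.S50.Scalars
import Summits.NavierStokesRegularity.TurbBounds.Certs.S50.B001
import Summits.NavierStokesRegularity.TurbBounds.Certs.S50.B002

/-!
# Certificate S50 (CERTIFIED.md row R2-50: FW16 2-D stress-driven shear, Γx 2, Gr 50 (laminar-sharp soundness row), C_ε ≤ 0.020000000002) — the FINITE PART assembled: all 2 LMI blocks positive semidefinite

One citable conjunction over the sibling block files (each block kernel-checked there by `decide +kernel` against the audited predicates of `Literature/Computation/Certificates/*`): for every certified mode m = 1…2 the integer matrix `B00m.A` (= the container's `Cn = den·Q_m`, identity asserted on the hub and re-verified by the referee's leanspot tool) is positive semidefinite over `ℚ` and, cast, over `ℝ`. Together with `S50.Scalars` (scalar lines: claim arithmetic, outward decimals, cutoff instance making every mode m ≥ 3 free, tail-slack signs) this is the finite part of the certificate; NOT in Lean (paper + referee): the identity Cn = den·Q_m with the analytic LMI, the tail lemmas and the cited reduction. Container pub-turb-shear/certs/T7-fw16-Gx2-Gr50-P4-N12-j111081 (rbcert/0 sha256 9bdcefff37d2376c…). Blocks B001, B002 (dim 38) landed 2026-08-21 (p250075, p250239); Scalars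 p250059.HONEST FRAMING: rigorous bounds for the stated PDE and boundary conditions; no claim about physical turbulence beyond the bound.
-/

namespace Summit.NavierStokesRegularity.TurbBounds.Certs.S50

/-- **All 2 LMI blocks of certificate S50 are positive semidefinite** (over `ℚ`). -/
theorem blocks_posSemidef_rat :
    B001.A.PosSemidef ∧
    B002.A.PosSemidef :=
  ⟨B001.posSemidef_rat, B002.posSemidef_rat⟩

/-- … and over `ℝ` (the casts `B00m.A.map Rat.cast`). -/
theorem blocks_posSemidef :
    (B001.A.map (Rat.cast : ℚ → ℝ)).PosSemidef ∧
    (B002.A.map (Rat.cast : ℚ → ℝ)).PosSemidef :=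
  ⟨B001.posSemidef, B002.posSemidef⟩

end Summit.NavierStokesRegularity.TurbBounds.Certs.S50
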